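import Summits.AtomisticToContinuum.Crystallization.Theorems.ExcessDecayLiouvilleHcpLiouvilleSecant
import Summits.AtomisticToContinuum.Crystallization.Theorems.ExcessDecayLiouvilleHcpLiouvilleGeometry

/-!
# `ExcessDecayLiouville.HcpLiouville` (stmt-AtomisticToContinuum-9332), line `Sketch`, level 1: the secant linear equation

Helper for stub `stub_levelOneGrowth` of the line `two-level-caccioppoli` (crux `HcpLiouville`).  Setting:
an admissible hcp datum `(t, A)` (`Adm₀ A`, `Inner₀ t A`), an anchor `τ` with `Inner₀ (anchorDatum t τ) A`,
a displacement `u` with `IsDisplacement X t A u`, and BOTH `X` and the anchored two-lattice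
`S* = Sites₀ (anchorDatum t τ) A` in Lennard-Jones force balance (`Equil₀`).  With the field
`v = LevelOne.vField t A τ u` on `S*` (so that `p + v p ∈ X` is the particle attached to `p ∈ S*`) and the
secant force-constant matrices `B_pq(w, w') = LevelOne.secK (p − q) (v p − v q) w w'`:

* `LevelOne.linear_eq` — **the secant linear equation** `Σ_q B_pq(v p − v q, w') = 0` for every `p ∈ S*`
  and every `w'` (difference of the two force balances, reindexed along the bijection `S* → X`, and the
  secant identity `⟪F(e + d) − F(e), w'⟫ = secK e d d w'`: EXACT, no Taylor remainder);
* `LevelOne.abs_B_le` — `|B_pq(w, w')| ≤ k(p,q)‖w‖‖w'‖` with the row-summable kernel `LevelOne.ker`;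
* row summability lemmas for the families `q ↦ B_pq(W q, W' q)` used by the Caccioppoli identity;
* `LevelOne.growth_sum_le_nnForm` — the read-out: the `GrowthBound` double sum of `u − τ𝟙₁` over the reference
  sites is dominated by `nnForm (anchorDatum t τ) A φ` for any test field `φ` equal to `v` near the ball
  (transport along the site equivalence `LevelOne.siteEquiv = fwd`).

All `[folklore]`; a `--supports` helper file for item stmt-AtomisticToContinuum-9332, nothing here closes
an item.
-/

noncomputable section

namespace Summit.AtomisticToContinuum.Crystallization.Theorems.ExcessDecayLiouville

open scoped BigOperators Topology Classical InnerProductSpace RealInnerProductSpace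
open Literature.MathematicalPhysics.StatisticalMechanics
open Summit.AtomisticToContinuum.Crystallization.Theses.ExcessDecayLiouville
open Summit.AtomisticToContinuum.Crystallization.Theorems.PhononStabilityNegative

local notation "E3" => EuclideanSpace ℝ (Fin 3)

namespace LevelOne

variable {t : Fin 2 → E3} {A : E3 →L[ℝ] E3} {τ : E3} {X : Set E3} {u : E3 → E3}

/-! ## The site equivalence and the particle bijection -/

/-- **The site equivalence** `fwd : Sites₀ t A ≃ Sites₀ (anchorDatum t τ) A`. [folklore] -/
def siteEquiv (hA : Adm₀ A) (hI : Inner₀ t A) (hIτ : Inner₀ (anchorDatum t τ) A) :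
    Sites₀ t A ≃ Sites₀ (anchorDatum t τ) A where
  toFun s := ⟨fwd t A τ s, fwd_mem hA hI s.2⟩
  invFun p := ⟨bwd t A τ p, bwd_mem hA hIτ p.2⟩
  left_inv s := Subtype.ext (bwd_fwd hA hI hIτ s.2)
  right_inv p := Subtype.ext (fwd_bwd hA hI hIτ p.2)

/-- The site equivalence is `fwd` on points. [folklore] -/
@[simp] theorem siteEquiv_apply (hA : Adm₀ A) (hI : Inner₀ t A) (hIτ : Inner₀ (anchorDatum t τ) A)
    (s : Sites₀ t A) : (siteEquiv hA hI hIτ s : E3) = fwd t A τ s := rfl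

/-- `bwd` is a bijection from the anchored sites onto the reference sites. [folklore] -/
theorem bijOn_bwd (hA : Adm₀ A) (hI : Inner₀ t A) (hIτ : Inner₀ (anchorDatum t τ) A) :
    Set.BijOn (bwd t A τ) (Sites₀ (anchorDatum t τ) A) (Sites₀ t A) :=
  Set.BijOn.mk (fun p hp => bwd_mem hA hIτ hp)
    (fun p hp q hq h => by rw [← fwd_bwd hA hI hIτ hp, ← fwd_bwd hA hI hIτ hq, h])
    (fun s hs => ⟨fwd t A τ s, fwd_mem hA hI hs, bwd_fwd hA hI hIτ hs⟩)

/-- **The particles are a bijective image of the anchored sites** under `p ↦ p + v p`. [folklore] -/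
theorem bijOn_particle {X : Set E3} {u : E3 → E3} (hA : Adm₀ A) (hI : Inner₀ t A)
    (hIτ : Inner₀ (anchorDatum t τ) A) (hu : IsDisplacement X t A u) :
    Set.BijOn (fun p => p + vField t A τ u p) (Sites₀ (anchorDatum t τ) A) X := by
  have h := hu.2.comp (bijOn_bwd hA hI hIτ)
  refine h.congr fun p _ => ?_
  simp only [Function.comp_apply, add_vField]

/-! ## The secant linear equation -/

/-- The particle map restricted off one site is a bijection onto the particles off its image. [folklore] -/
theorem bijOn_particle_ne (hA : Adm₀ A) (hI : Inner₀ t A) (hIτ : Inner₀ (anchorDatum t τ) A)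
    (hu : IsDisplacement X t A u) {p : E3} (hp : p ∈ Sites₀ (anchorDatum t τ) A) :
    Set.BijOn (fun q => q + vField t A τ u q) {q | q ∈ Sites₀ (anchorDatum t τ) A ∧ q ≠ p}
      {y | y ∈ X ∧ y ≠ p + vField t A τ u p} := by
  have h := bijOn_particle hA hI hIτ hu
  refine Set.BijOn.mk ?_ ?_ ?_
  · intro q hq
    exact ⟨h.mapsTo hq.1, fun heq => hq.2 (h.injOn hq.1 hp heq)⟩
  · exact h.injOn.mono fun q hq => hq.1
  · intro y hy
    obtain ⟨q, hq, rfl⟩ := h.surjOn hy.1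
    exact ⟨q, ⟨hq, fun hqp => hy.2 (by simp only [hqp])⟩, rfl⟩

/-- **The secant linear equation.**  For `p ∈ S*` and every test vector `w'`,
`Σ_{q ∈ S*} secK (p − q) (v p − v q) (v p − v q) w' = 0` (as a `HasSum`; the diagonal term vanishes).
[folklore] -/
theorem linear_eq (hA : Adm₀ A) (hI : Inner₀ t A) (hIτ : Inner₀ (anchorDatum t τ) A)
    (hu : IsDisplacement X t A u) (hEX : Equil₀ X) (hEτ : Equil₀ (Sites₀ (anchorDatum t τ) A))
    {p : E3} (hp : p ∈ Sites₀ (anchorDatum t τ) A) (w' : E3) :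
    HasSum (fun q : Sites₀ (anchorDatum t τ) A =>
      secK (p - q) (vField t A τ u p - vField t A τ u q) (vField t A τ u p - vField t A τ u q) w') 0 := by
  have hB := bijOn_particle_ne hA hI hIτ hu hp
  have hxp : p + vField t A τ u p ∈ X := (bijOn_particle hA hI hIτ hu).mapsTo hp
  -- force balance of `X` at the particle of `p`, reindexed over the anchored sites
  have h1 := ((hB.equiv _).hasSum_iff (f := fun y : ({y : E3 | y ∈ X ∧ y ≠ p + vField t A τ u p} : Set E3) =>
      (deriv lennardJones (dist (p + vField t A τ u p) y.1) / dist (p + vField t A τ u p) y.1) •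
        (p + vField t A τ u p - y.1))).2 (hEX _ hxp)
  -- force balance of `S*` at `p`
  have h2 := hEτ p hp
  have h3 := (h1.sub h2).mapL (innerSL ℝ w')
  rw [sub_self, map_zero] at h3
  -- the summands are the secant terms
  set f : E3 → ℝ := fun q => secK (p - q) (vField t A τ u p - vField t A τ u q)
    (vField t A τ u p - vField t A τ u q) w' with hf
  have h4 : HasSum (fun q : ({q : E3 | q ∈ Sites₀ (anchorDatum t τ) A ∧ q ≠ p} : Set E3) => f q) 0 := by
    refine h3.congr_fun fun q => ?_
    have hEq : ((hB.equiv _ q : ({y : E3 | y ∈ X ∧ y ≠ p + vField t A τ u p} : Set E3)) : E3) =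
        q.1 + vField t A τ u q.1 := rfl
    have hne : p ≠ q.1 := fun h => q.2.2 h.symm
    have he : (23 / 25 : ℝ) ≤ ‖p - q.1‖ := by
      rw [← dist_eq_norm]; exact dist_sites_ge hA hIτ hp q.2.1 hne
    have hd : ‖vField t A τ u p - vField t A τ u q.1‖ < ‖p - q.1‖ :=
      (norm_vField_sub_le hA hI hIτ hu hp q.2.1).trans_lt (by linarith)
    have hsplit : p + vField t A τ u p - (q.1 + vField t A τ u q.1) =
        (p - q.1) + (vField t A τ u p - vField t A τ u q.1) := by abel
    simp only [hf, Function.comp_apply, innerSL_apply_apply, hEq, dist_eq_norm, hsplit]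
    first
      | rw [inner_force_sub_force _ _ _ hd]
      | rw [real_inner_comm, inner_force_sub_force _ _ _ hd]
  -- pass from `S* ∖ {p}` to `S*`: the diagonal term is `secK 0 0 0 w' = 0`
  have h5 : HasSum (Set.indicator {q : E3 | q ∈ Sites₀ (anchorDatum t τ) A ∧ q ≠ p} f) 0 :=
    (hasSum_subtype_iff_indicator (f := f) (s := {q : E3 | q ∈ Sites₀ (anchorDatum t τ) A ∧ q ≠ p})).1 h4
  have hind : Set.indicator {q : E3 | q ∈ Sites₀ (anchorDatum t τ) A ∧ q ≠ p} f =
      Set.indicator (Sites₀ (anchorDatum t τ) A) f := by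
    funext q
    by_cases hqp : q = p
    · subst hqp
      have hfq : f q = 0 := by simp [hf]
      rw [Set.indicator_of_notMem (fun h => h.2 rfl), Set.indicator_of_mem hp, hfq]
    · by_cases hq : q ∈ Sites₀ (anchorDatum t τ) A
      · rw [Set.indicator_of_mem (show q ∈ {q : E3 | q ∈ Sites₀ (anchorDatum t τ) A ∧ q ≠ p} from ⟨hq, hqp⟩),
          Set.indicator_of_mem hq]
      · rw [Set.indicator_of_notMem (fun h => hq h.1), Set.indicator_of_notMem hq]
  rw [hind] at h5
  exact (hasSum_subtype_iff_indicator (f := f) (s := Sites₀ (anchorDatum t τ) A)).2 h5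

/-- The linear equation in `tsum` form. [folklore] -/
theorem tsum_linear_eq (hA : Adm₀ A) (hI : Inner₀ t A) (hIτ : Inner₀ (anchorDatum t τ) A)
    (hu : IsDisplacement X t A u) (hEX : Equil₀ X) (hEτ : Equil₀ (Sites₀ (anchorDatum t τ) A))
    {p : E3} (hp : p ∈ Sites₀ (anchorDatum t τ) A) (w' : E3) :
    ∑' q : Sites₀ (anchorDatum t τ) A,
      secK (p - q) (vField t A τ u p - vField t A τ u q) (vField t A τ u p - vField t A τ u q) w' = 0 :=
  (linear_eq hA hI hIτ hu hEX hEτ hp w').tsum_eq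

/-! ## The secant matrices and their kernel bound -/

/-- **Kernel bound for the secant matrices**: `|secK (p − q) (v p − v q) w w'| ≤ k(p,q)‖w‖‖w'‖` on the
anchored sites (both sides vanish on the diagonal). [folklore] -/
theorem abs_B_le (hA : Adm₀ A) (hI : Inner₀ t A) (hIτ : Inner₀ (anchorDatum t τ) A)
    (hu : IsDisplacement X t A u) {p q : E3} (hp : p ∈ Sites₀ (anchorDatum t τ) A)
    (hq : q ∈ Sites₀ (anchorDatum t τ) A) (w w' : E3) :
    |secK (p - q) (vField t A τ u p - vField t A τ u q) w w'| ≤ ker p q * ‖w‖ * ‖w'‖ := by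
  rcases eq_or_ne p q with rfl | hne
  · simp
  · have he : (23 / 25 : ℝ) ≤ ‖p - q‖ := by rw [← dist_eq_norm]; exact dist_sites_ge hA hIτ hp hq hne
    have h := abs_secK_le he (norm_vField_sub_le hA hI hIτ hu hp hq) w w'
    rwa [ker_of_ne hne, dist_eq_norm]

/-- The secant matrices are symmetric under `p ↔ q`. [folklore] -/
theorem B_swap (v : E3 → E3) (p q w w' : E3) :
    secK (q - p) (v q - v p) w w' = secK (p - q) (v p - v q) w w' := by
  rw [← secK_neg_neg, neg_sub, neg_sub]

/-- `secK` is odd in `w`. [folklore] -/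
theorem secK_neg_left (e d w w' : E3) : secK e d (-w) w' = -secK e d w w' := by
  rw [← neg_one_smul ℝ w, secK_smul_left]; ring

/-- Antisymmetry of the strain-tested secant terms under `p ↔ q`:
`B_pq(v p − v q, w') = −B_qp(v q − v p, w')`. [folklore] -/
theorem B_antisymm (v : E3 → E3) (p q w' : E3) :
    secK (p - q) (v p - v q) (v p - v q) w' = -secK (q - p) (v q - v p) (v q - v p) w' := by
  rw [← B_swap v p q, ← neg_sub (v q) (v p), secK_neg_left]

/-- Subtractivity of the secant matrices in the second slot, valid on all of `S* × S*` (on the diagonal both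
sides vanish). [folklore] -/
theorem B_sub_right (hA : Adm₀ A) (hI : Inner₀ t A) (hIτ : Inner₀ (anchorDatum t τ) A)
    (hu : IsDisplacement X t A u) {p q : E3} (hp : p ∈ Sites₀ (anchorDatum t τ) A)
    (hq : q ∈ Sites₀ (anchorDatum t τ) A) (w w₁ w₂ : E3) :
    secK (p - q) (vField t A τ u p - vField t A τ u q) w (w₁ - w₂) =
      secK (p - q) (vField t A τ u p - vField t A τ u q) w w₁ -
        secK (p - q) (vField t A τ u p - vField t A τ u q) w w₂ := by
  rcases eq_or_ne p q with rfl | hne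
  · simp
  · have he : (23 / 25 : ℝ) ≤ ‖p - q‖ := by rw [← dist_eq_norm]; exact dist_sites_ge hA hIτ hp hq hne
    exact secK_sub_right ((norm_vField_sub_le hA hI hIτ hu hp hq).trans_lt (by linarith)) w w₁ w₂

/-- The cut-off identity for the secant matrices, valid on all of `S* × S*`. [folklore] -/
theorem B_cutoff_identity (hA : Adm₀ A) (hI : Inner₀ t A) (hIτ : Inner₀ (anchorDatum t τ) A)
    (hu : IsDisplacement X t A u) {p q : E3} (hp : p ∈ Sites₀ (anchorDatum t τ) A)
    (hq : q ∈ Sites₀ (anchorDatum t τ) A) (a b : ℝ) (G H : E3) (hab : p = q → a = b) :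
    secK (p - q) (vField t A τ u p - vField t A τ u q) (a • G - b • H) (a • G - b • H) =
      secK (p - q) (vField t A τ u p - vField t A τ u q) (G - H) (a ^ 2 • G - b ^ 2 • H) +
        (a - b) ^ 2 * secK (p - q) (vField t A τ u p - vField t A τ u q) G H := by
  rcases eq_or_ne p q with rfl | hne
  · simp [hab rfl]
  · have he : (23 / 25 : ℝ) ≤ ‖p - q‖ := by rw [← dist_eq_norm]; exact dist_sites_ge hA hIτ hp hq hne
    exact secK_cutoff_identity ((norm_vField_sub_le hA hI hIτ hu hp hq).trans_lt (by linarith)) a b G H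

/-! ## Row summability -/

/-- **Row summability**: for bounded fields `W`, `W'` on the anchored sites, the row family
`q ↦ secK (p − q) (v p − v q) (W q) (W' q)` is summable, dominated by `c c'·k(p, ·)`. [folklore] -/
theorem summable_row (hA : Adm₀ A) (hI : Inner₀ t A) (hIτ : Inner₀ (anchorDatum t τ) A)
    (hu : IsDisplacement X t A u) {p : E3} (hp : p ∈ Sites₀ (anchorDatum t τ) A)
    (W W' : Sites₀ (anchorDatum t τ) A → E3) {c c' : ℝ} (hW : ∀ q, ‖W q‖ ≤ c) (hW' : ∀ q, ‖W' q‖ ≤ c') :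
    Summable fun q : Sites₀ (anchorDatum t τ) A =>
      secK (p - q) (vField t A τ u p - vField t A τ u q) (W q) (W' q) := by
  have hc : 0 ≤ c := (norm_nonneg _).trans (hW ⟨p, hp⟩)
  refine Summable.of_norm_bounded ((summable_ker hA hIτ hp).mul_left (c * c')) fun q => ?_
  rw [Real.norm_eq_abs]
  calc |secK (p - q) (vField t A τ u p - vField t A τ u q) (W q) (W' q)|
      ≤ ker p q * ‖W q‖ * ‖W' q‖ := abs_B_le hA hI hIτ hu hp q.2 _ _
    _ ≤ ker p q * c * c' := by
        have hk := ker_nonneg p q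
        have hkc : 0 ≤ ker p q * c := mul_nonneg hk hc
        gcongr
        · exact hW q
        · exact hW' q
    _ = c * c' * ker p q := by ring

/-- **Row sum bound**: `|Σ_q secK (p − q) (v p − v q) (W q) (W' q)| ≤ c c' Σ_q k(p,q)`. [folklore] -/
theorem abs_tsum_row_le (hA : Adm₀ A) (hI : Inner₀ t A) (hIτ : Inner₀ (anchorDatum t τ) A)
    (hu : IsDisplacement X t A u) {p : E3} (hp : p ∈ Sites₀ (anchorDatum t τ) A)
    (W W' : Sites₀ (anchorDatum t τ) A → E3) {c c' : ℝ} (hW : ∀ q, ‖W q‖ ≤ c) (hW' : ∀ q, ‖W' q‖ ≤ c') :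
    |∑' q : Sites₀ (anchorDatum t τ) A, secK (p - q) (vField t A τ u p - vField t A τ u q) (W q) (W' q)| ≤
      c * c' * ∑' q : Sites₀ (anchorDatum t τ) A, ker p q := by
  have hc : 0 ≤ c := (norm_nonneg _).trans (hW ⟨p, hp⟩)
  rw [← tsum_mul_left, ← Real.norm_eq_abs]
  refine tsum_of_norm_bounded ((summable_ker hA hIτ hp).mul_left (c * c')).hasSum fun q => ?_
  rw [Real.norm_eq_abs]
  calc |secK (p - q) (vField t A τ u p - vField t A τ u q) (W q) (W' q)|
      ≤ ker p q * ‖W q‖ * ‖W' q‖ := abs_B_le hA hI hIτ hu hp q.2 _ _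
    _ ≤ ker p q * c * c' := by
        have hk := ker_nonneg p q
        have hkc : 0 ≤ ker p q * c := mul_nonneg hk hc
        gcongr
        · exact hW q
        · exact hW' q
    _ = c * c' * ker p q := by ring

/-! ## Read-out: transport of the nearest-neighbour strain sum back to the reference sites -/

/-- **Read-out and transport**: if a test field `φ` agrees with `v` on the anchored sites of `B_{R'}(c)`,
`R + 23/20 ≤ R'`, and vanishes on the anchored sites off `B_{R''}(c)`, then the `GrowthBound` double sum of
`u − τ𝟙₁` over the reference sites at radius `R` is at most `nnForm (anchorDatum t τ) A φ` (bonds and `‖·‖²`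
are transported along `fwd`, which moves points by `‖τ‖ ≤ 1/20` and keeps nearest-neighbour bonds). [folklore] -/
theorem growth_sum_le_nnForm (hA : Adm₀ A) (hI : Inner₀ t A) (hIτ : Inner₀ (anchorDatum t τ) A) (u φ : E3 → E3)
    (c : E3) {R R' R'' : ℝ} (hRR' : R + 23 / 20 ≤ R')
    (hφ1 : ∀ p ∈ Sites₀ (anchorDatum t τ) A, dist p c ≤ R' → φ p = vField t A τ u p)
    (hφ0 : ∀ p ∈ Sites₀ (anchorDatum t τ) A, R'' ≤ dist p c → φ p = 0) :
    (∑' p : {s : E3 // s ∈ Sites₀ t A ∧ dist s c ≤ R}, ∑' q : Sites₀ t A,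
      if dist (p : E3) q ≤ 11 / 10 then
        ‖(fun s => u s - shiftField t A τ s) p - (fun s => u s - shiftField t A τ s) q‖ ^ 2 else 0) ≤
    nnForm (anchorDatum t τ) A φ := by
  set N : Sites₀ (anchorDatum t τ) A → ℝ := fun p' => ∑' q' : Sites₀ (anchorDatum t τ) A,
    if dist (p' : E3) q' ≤ 11 / 10 then ‖φ p' - φ q'‖ ^ 2 else 0 with hN
  have hnn : nnForm (anchorDatum t τ) A φ = ∑' p', N p' := rfl
  rw [hnn]
  have hτ := norm_anchor_le hI hIτ
  -- the injection `fwd`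
  set e : {s : E3 // s ∈ Sites₀ t A ∧ dist s c ≤ R} → Sites₀ (anchorDatum t τ) A :=
    fun s => ⟨fwd t A τ s, fwd_mem hA hI s.2.1⟩ with he_def
  have he : Function.Injective e := by
    intro a b h
    have h' : fwd t A τ a = fwd t A τ b := congrArg Subtype.val h
    apply Subtype.ext
    rw [← bwd_fwd hA hI hIτ a.2.1, ← bwd_fwd hA hI hIτ b.2.1, h']
  -- `φ = v` on every bond seen from `fwd s`
  have hφ1' : ∀ s : {s : E3 // s ∈ Sites₀ t A ∧ dist s c ≤ R}, ∀ q' : E3, q' ∈ Sites₀ (anchorDatum t τ) A →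
      dist (fwd t A τ s) q' ≤ 11 / 10 → φ q' = vField t A τ u q' := by
    intro s q' hq' hd
    refine hφ1 q' hq' ?_
    have h1 := dist_fwd_le t A τ (s : E3) c
    have h3 := s.2.2
    have h4 := dist_triangle q' (fwd t A τ s) c
    rw [dist_comm q' (fwd t A τ s)] at h4
    linarith
  have hφfwd : ∀ s : E3, s ∈ Sites₀ t A → φ (fwd t A τ s) = vField t A τ u (fwd t A τ s) →
      φ (fwd t A τ s) = u s - shiftField t A τ s := by
    intro s hs h1
    rw [h1, vField_fwd hA hI hIτ u hs]
  -- termwise comparison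
  have hGN : ∀ s : {s : E3 // s ∈ Sites₀ t A ∧ dist s c ≤ R},
      (∑' q : Sites₀ t A, if dist (s : E3) q ≤ 11 / 10 then
        ‖(fun s => u s - shiftField t A τ s) s - (fun s => u s - shiftField t A τ s) q‖ ^ 2 else 0) ≤ N (e s) := by
    intro s
    have hs1 : φ (fwd t A τ s) = vField t A τ u (fwd t A τ s) :=
      hφ1' s _ (fwd_mem hA hI s.2.1) (by rw [dist_self]; norm_num)
    have hre : N (e s) = ∑' q : Sites₀ t A, (if dist (fwd t A τ s) (fwd t A τ q) ≤ 11 / 10 then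
        ‖φ (fwd t A τ s) - φ (fwd t A τ q)‖ ^ 2 else 0) :=
      ((siteEquiv hA hI hIτ).tsum_eq (fun q' : Sites₀ (anchorDatum t τ) A =>
        if dist (fwd t A τ s) (q' : E3) ≤ 11 / 10 then ‖φ (fwd t A τ s) - φ q'‖ ^ 2 else 0)).symm
    rw [hre]
    refine Summable.tsum_le_tsum (fun q => ?_) ?_ ?_
    · by_cases hd : dist (s : E3) q ≤ 11 / 10
      · have hd' := dist_fwd_fwd_le_of_nn hA hI hIτ s.2.1 q.2 hd
        rw [if_pos hd, if_pos hd', hφfwd s s.2.1 hs1, hφfwd q q.2 (hφ1' s _ (fwd_mem hA hI q.2) hd')]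
      · rw [if_neg hd]
        split_ifs <;> positivity
    · refine summable_of_ne_finset_zero (s := (finite_sites_ball hA hI (s : E3) (11 / 10)).toFinset) fun q hq => ?_
      rw [if_neg]
      intro hd
      exact hq ((Set.Finite.mem_toFinset _).2 (by rw [dist_comm] at hd; exact hd))
    · have hS' : Summable fun q' : Sites₀ (anchorDatum t τ) A =>
          if dist (fwd t A τ s) (q' : E3) ≤ 11 / 10 then ‖φ (fwd t A τ s) - φ q'‖ ^ 2 else 0 := by
        refine summable_of_ne_finset_zero (s := (finite_sites_ball hA hIτ (fwd t A τ s) (11 / 10)).toFinset)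
          fun q' hq' => ?_
        rw [if_neg]
        intro hd
        exact hq' ((Set.Finite.mem_toFinset _).2 (by rw [dist_comm] at hd; exact hd))
      exact (siteEquiv hA hI hIτ).summable_iff.2 hS'
  -- summability of both outer families
  haveI : Finite {s : E3 // s ∈ Sites₀ t A ∧ dist s c ≤ R} := (finite_sites_dist_le hA hI c R).to_subtype
  have hGs : Summable fun s : {s : E3 // s ∈ Sites₀ t A ∧ dist s c ≤ R} =>
      ∑' q : Sites₀ t A, (if dist (s : E3) q ≤ 11 / 10 then
        ‖(fun s => u s - shiftField t A τ s) s - (fun s => u s - shiftField t A τ s) q‖ ^ 2 else 0) :=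
    Summable.of_finite
  have hNs : Summable N := by
    refine summable_of_ne_finset_zero (s := (finite_sites_ball hA hIτ c (R'' + 11 / 10)).toFinset) fun p' hp' => ?_
    have hfar : R'' + 11 / 10 < dist (p' : E3) c := not_le.1 fun h => hp' ((Set.Finite.mem_toFinset _).2 h)
    have hφp : φ p' = 0 := hφ0 _ p'.2 (by linarith)
    simp only [hN]
    refine (tsum_congr fun q' => ?_).trans tsum_zero
    by_cases hd : dist (p' : E3) q' ≤ 11 / 10
    · have h4 := dist_triangle (p' : E3) q' c
      have hφq : φ q' = 0 := hφ0 _ q'.2 (by linarith)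
      rw [if_pos hd, hφp, hφq, sub_zero, norm_zero]
      norm_num
    · rw [if_neg hd]
  exact Summable.tsum_le_tsum_of_inj e he (fun p' _ => tsum_nonneg fun q' => by split_ifs <;> positivity) hGN hGs hNs

end LevelOne

/-- Registered sub-goal carrying this helper file (crux stmt-AtomisticToContinuum-9332, line `Sketch`, level 1):
the secant linear equation of an anchored displacement. [folklore] -/
theorem levelOne_linearEq : ∀ (X : Set E3) (t : Fin 2 → E3) (A : E3 →L[ℝ] E3) (u : E3 → E3) (τ : E3), Adm₀ A → Inner₀ t A → Inner₀ (anchorDatum t τ) A → IsDisplacement X t A u → Equil₀ X → Equil₀ (Sites₀ (anchorDatum t τ) A) → ∀ p ∈ Sites₀ (anchorDatum t τ) A, ∀ w' : E3, HasSum (fun q : Sites₀ (anchorDatum t τ) A => LevelOne.secK (p - q) (LevelOne.vField t A τ u p - LevelOne.vField t A τ u q) (LevelOne.vField t A τ u p - LevelOne.vField t A τ u q) w') 0 := by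
  intro X t A u τ hA hI hIτ hu hEX hEτ p hp w'
  exact LevelOne.linear_eq hA hI hIτ hu hEX hEτ hp w'

end Summit.AtomisticToContinuum.Crystallization.Theorems.ExcessDecayLiouville

end
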